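import Literature.NumberTheory.PAdicHodge.TateTwistInvariants
import Literature.NumberTheory.PAdicHodge.BlochKatoDualExponential
import Literature.IUT.LogVolume.UnitLogKernel
import HarnessLib

/-!
# Tate's theorem, `H¹` half (scalar case): `log χ_cyclo` is not a coboundary in `ℂ_F`

Continuation of `TateInvariantsBase` / `TateTwistInvariants` (the `H⁰` half: `ℂ_F(χ^j)^{Γ_F} = 0`,
`j ≠ 0`). Notation as there: `F` a non-archimedean local field of characteristic `0` and residue
characteristic `p`, `K₀ = PadicBase F p hp ≅ ℚ_p`, `F̄ = NormedAlgClosure F`, `ℂ_F = CompletedAlgClosure F`,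
`G₀ = BaseGaloisGroup hp = Gal(F̄/K₀)`, `χ : G₀ → ℤ_pˣ` the cyclotomic character, `K_∞ = K₀(μ_{p^∞})`,
`X = \widehat{K_∞} ⊆ ℂ_F`, `R_n = TateTrace.Rhat n : X → ℂ_F` Tate's normalised trace, `γ = gen n`.

**Theorem** (`CompletedAlgClosure.not_exists_smul_eq_add_logCyclotomic`). For `a ∈ ℚ_p`, `a ≠ 0`, there
is NO `c ∈ ℂ_F` with `σ • c = c + a · log χ_F(σ)` for all `σ ∈ Γ_F` (the scalar `a · log χ_F(σ) ∈ ℚ_p`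
mapped through `ℚ_p → F → ℂ_F`). In other words the continuous `1`-cocycle `log χ_cyclo : Γ_F → ℚ_p ⊆ ℂ_F`
(Kato's `log(χ_cyclo) ∈ H¹(K, ℤ_p)`, tree `logCyclotomic`) spans a LINE in `H¹(Γ_F, ℂ_F)`: the class
`[log χ] ≠ 0`. This is the `H¹` companion (Tate 1967, §3.3, Theorem 1: `H¹(K, C) ≅ K`, generated by
`log χ`; Theorem 2: `H¹(K, C(χ)) = 0` for `χ` of infinite order is NOT proved here) of the tree's `H⁰`
theorem `CompletedAlgClosure.eq_zero_of_forall_smul_eq_cyclotomicCharacter_zpow`, and it is the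
`V = ℚ_p` instance of the injectivity half of Kato, LNM 1553, Ch. II Prop. 1.2.3 (`∪ log χ` is injective on
`D⁰_dR`) — the cite-only tree fact `cupLogInjective_and_hasDualExp_of_isDeRham` restricted to the
trivial representation and to `gr⁰ B_dR⁺ = ℂ_F`.

Proof (Tate 1967 §3.2–3.3; Fontaine–Ouyang §3.2).
1. COBOUNDARY CRITERION over the base (`TateTrace.eq_zero_of_gen_smul_eq_add`): if `c ∈ X` and
   `γ • c = c + ι b` with `b ∈ K₀`, `γ = gen n`, `n ≥ 2`, then `b = 0` — apply `R_n`: `R_n(γ c) = R_n c`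
   (tree `Rhat_genX`) while `R_n(c + ι b) = R_n c + ι b` (`R_n` is additive and the identity on `K₀`, proved
   here: `Rhat_add`, `Rhat_ι`).
2. BASE CASE (`TateTrace.apply_chi_gen_eq_zero_of_forall_smul_eq_add`): if `g • c = c + ι ℓ(χ g)` for all
   `g ∈ G₀` with `ℓ 1 = 0`, then `c` is fixed by `ker χ = Gal(F̄/K_∞)`, so `c ∈ X` by Ax–Sen–Tate (tree
   `fixedPoints_eq_X`), and step 1 gives `ℓ(χ(γ)) = 0`.
3. DESCENT `G₀ ⇝ Γ_F` (`TateDescent.apply_chi_gen_eq_zero_of_forall_toBase_smul_eq_add`), the additive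
   twin of the tree's norm transfer `TateDescent.smul_norm_eq`: with coset representatives `s_φ`
   (`φ : F → F̄` over `K₀`) and `g s_φ = s_{gφ} h_φ`, `h_φ ∈ Γ_F`, the TRACE `y = Σ_φ s_φ • c` satisfies
   `g • y = y + ι ℓ(χ(g)^d)`, `d = [F : ℚ_p]`, for `ℓ` logarithmic (`ℓ(uv) = ℓ u + ℓ v`), because
   `∏_φ χ(h_φ) = χ(g)^d`; step 2 for `u ↦ ℓ(u^d) = d ℓ(u)` gives `d · ℓ(χ γ) = 0`, so `ℓ(χ γ) = 0`.
4. For `ℓ = a · log_p` (`IUT.LogVolume.unitLog`, a homomorphism on units, tree `unitLog_mul`):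
   `log_p χ(γ) = 0` forces `χ(γ)` to be a root of unity (tree `unitLog_eq_zero_iff`), contradicting the
   tree's `zpow_chi_gen_ne_one` (`χ(γ) = 1 + p^n a`, `p ∤ a`, has infinite order).

No named facts; nothing cite-only is used. What is NOT here: `H¹(K, C(χ^j)) = 0` for `j ≠ 0`
(Theorem 2, `H¹` half), the surjectivity `H¹(K, C) = K · log χ`, and any statement for non-trivial `V`.

## References

* J. Tate, *p-divisible groups* (1967), §3.2 Prop. 7–8 and §3.3 Theorems 1–2. [Tate1967]
* J.-M. Fontaine, Y. Ouyang, *Theory of p-adic Galois representations*, §3.2 (Prop. 3.18,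
  Thm. 3.21: `H¹(G_K, C) = K · [log χ]`). [FontaineOuyang2022]
* K. Kato, LNM 1553 (1993), Ch. II §1.2.2 (`log χ_cyclo`), Prop. 1.2.3. [Kato1993LNM1553]
-/

noncomputable section

open ValuativeRel Field UniformSpace Filter Topology Finset

open scoped IntermediateField

namespace Literature.NumberTheory.PAdicHodge

open Literature.NumberTheory.GaloisRepresentations
open Literature.NumberTheory.GaloisRepresentations.IsNonarchimedeanLocalField
open CyclotomicTower

variable {F : Type} [Field F] [ValuativeRel F] [TopologicalSpace F] [IsNonarchimedeanLocalField F]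
  [CharZero F] {p : ℕ} [Fact p.Prime] (hp : valuation F p < 1)

namespace TateTrace

/-! ### `X` is an additive subgroup containing `K₀`; `R_n` is additive and the identity on `K₀` -/

/-- `S` (the image of `K_∞` in `ℂ_F`) is closed under addition. [cite: Tate1967, §3.1] -/
theorem add_mem_S {s t : CompletedAlgClosure F} (hs : s ∈ S hp) (ht : t ∈ S hp) : s + t ∈ S hp := by
  obtain ⟨y, hy, rfl⟩ := (mem_S_iff hp).mp hs
  obtain ⟨z, hz, rfl⟩ := (mem_S_iff hp).mp ht
  exact (mem_S_iff hp).mpr ⟨y + z, add_mem hy hz, Completion.coe_add y z⟩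

/-- `X = \widehat{K_∞}` is closed under addition. [cite: Tate1967, §3.1] -/
theorem add_mem_X {x a : CompletedAlgClosure F} (hx : x ∈ X hp) (ha : a ∈ X hp) : x + a ∈ X hp :=
  map_mem_closure₂ continuous_add hx ha fun _ hs _ ht => add_mem_S hp hs ht

/-- The scalars `ι b`, `b ∈ K₀`, lie in `S` (indeed in every layer `K M`). [folklore] -/
theorem ι_mem_S (b : PadicBase F p hp) : ι hp b ∈ S hp :=
  (mem_S_iff hp).mpr ⟨algebraMap (PadicBase F p hp) (NormedAlgClosure F) b,
    K_le_Kinf hp 0 (IntermediateField.algebraMap_mem _ b),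
    by rw [PadicBase.algebraMap_closure_eq, ι_def, CompletedAlgClosure.algebraMap_eq_coe]⟩

/-- The scalars `ι b` lie in `X`. [folklore] -/
theorem ι_mem_X (b : PadicBase F p hp) : ι hp b ∈ X hp := S_subset_X hp (ι_mem_S hp b)

/-- An average over a Galois orbit of a FIXED element is the element. [folklore] -/
private theorem avg_eq_self_of_smul_eq {δ : BaseGaloisGroup hp} {x : NormedAlgClosure F} (hx : δ • x = x)
    {N : ℕ} (hN : N ≠ 0) : avg hp δ N x = x := by
  have hk : ∀ k : ℕ, δ ^ k • x = x := by
    intro k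
    induction k with
    | zero => rw [pow_zero, one_smul]
    | succ k ih => rw [pow_succ, mul_smul, hx, ih]
  have hN0 : (N : PadicBase F p hp) ≠ 0 := Nat.cast_ne_zero.mpr hN
  rw [avg_def, Finset.sum_congr rfl fun k _ => hk k, Finset.sum_const, Finset.card_range,
    ← Nat.cast_smul_eq_nsmul (PadicBase F p hp), smul_smul, inv_mul_cancel₀ hN0, one_smul]

variable {n : ℕ}

/-- **`R_n` is additive on `S`.** [cite: Tate1967, §3.1] -/
theorem Rfun_add (hn : 1 ≤ n) (s t : S hp) (h : (s : CompletedAlgClosure F) + t ∈ S hp) :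
    Rfun hp n ⟨(s : CompletedAlgClosure F) + t, h⟩ = Rfun hp n s + Rfun hp n t := by
  obtain ⟨y, z, M, hy, hz, hM, hyM, hzM⟩ := exists_common_level hp n s t
  have hyz : ((y + z : NormedAlgClosure F) : CompletedAlgClosure F) = (s : CompletedAlgClosure F) + t := by
    rw [Completion.coe_add, hy, hz]
  rw [Rfun_eq hp hn hyz hM (add_mem hyM hzM), Rfun_eq hp hn hy hM hyM, Rfun_eq hp hn hz hM hzM,
    traceToLevel_add, Completion.coe_add]

/-- **`R_n` is the identity on `K₀`**: `R_n (ι b) = ι b`. [cite: Tate1967, §3.1] -/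
theorem Rfun_ι (hn : 1 ≤ n) (b : PadicBase F p hp) (h : ι hp b ∈ S hp) :
    Rfun hp n ⟨ι hp b, h⟩ = ι hp b := by
  have hy : ((algebraMap (PadicBase F p hp) (NormedAlgClosure F) b : NormedAlgClosure F) :
      CompletedAlgClosure F) = ι hp b := by
    rw [PadicBase.algebraMap_closure_eq, ι_def, CompletedAlgClosure.algebraMap_eq_coe]
  rw [Rfun_eq hp hn hy (le_refl (n + 1)) (IntermediateField.algebraMap_mem _ b), traceToLevel_def,
    avg_eq_self_of_smul_eq hp (BaseGaloisGroup.smul_algebraMap hp (gen hp n) b) (pow_pos' _).ne', hy]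

/-- **`R_n` is additive on `X`** (by density from `S`). [cite: Tate1967, §3.1] -/
theorem Rhat_add (hn : 2 ≤ n) (x a : X hp) :
    Rhat hp n ⟨(x : CompletedAlgClosure F) + a, add_mem_X hp x.2 a.2⟩ = Rhat hp n x + Rhat hp n a := by
  have hcont : Continuous fun q : X hp × X hp =>
      (⟨(q.1 : CompletedAlgClosure F) + q.2, add_mem_X hp q.1.2 q.2.2⟩ : X hp) :=
    ((continuous_subtype_val.comp continuous_fst).add
      (continuous_subtype_val.comp continuous_snd)).subtype_mk _
  refine (denseRange_incl hp).induction_on₂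
    (p := fun x a : X hp => Rhat hp n ⟨(x : CompletedAlgClosure F) + a, add_mem_X hp x.2 a.2⟩ =
      Rhat hp n x + Rhat hp n a)
    (isClosed_eq ((continuous_Rhat hp hn).comp hcont)
      (((continuous_Rhat hp hn).comp continuous_fst).add ((continuous_Rhat hp hn).comp continuous_snd)))
    (fun s t => ?_) x a
  have hmem : (s : CompletedAlgClosure F) + t ∈ S hp := add_mem_S hp s.2 t.2
  have h1 : (⟨((incl hp s : X hp) : CompletedAlgClosure F) + (incl hp t : X hp),
      add_mem_X hp (incl hp s).2 (incl hp t).2⟩ : X hp) =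
      incl hp ⟨(s : CompletedAlgClosure F) + t, hmem⟩ := rfl
  rw [h1, Rhat_incl hp hn, Rhat_incl hp hn, Rhat_incl hp hn, Rfun_add hp (by omega)]

/-- **`R_n (ι b) = ι b` on `X`.** [cite: Tate1967, §3.1] -/
theorem Rhat_ι (hn : 2 ≤ n) (b : PadicBase F p hp) : Rhat hp n ⟨ι hp b, ι_mem_X hp b⟩ = ι hp b := by
  have h1 : (⟨ι hp b, ι_mem_X hp b⟩ : X hp) = incl hp ⟨ι hp b, ι_mem_S hp b⟩ := rfl
  rw [h1, Rhat_incl hp hn, Rfun_ι hp (by omega)]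

/-! ### The coboundary criterion and the base case -/

/-- **Tate's coboundary criterion (scalar case).** Let `n ≥ 2`, `c ∈ X = \widehat{K_∞}`, `b ∈ K₀`, and
suppose `γ • c = c + ι b` for `γ = gen n`. Then `b = 0`: applying the normalised trace,
`R_n c = R_n (γ c) = R_n c + ι b`. (Equivalently: a constant cocycle of `⟨γ⟩` with values in `K₀` that
is a coboundary in `X` vanishes — Tate's `H¹(Γ, X) = K`, coboundary half.)
[cite: Tate1967, §3.2 Prop. 8 and §3.3 Theorem 1] [cite: FontaineOuyang2022, §3.2 Prop. 3.18] -/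
theorem eq_zero_of_gen_smul_eq_add (hn : 2 ≤ n) {c : CompletedAlgClosure F} (hc : c ∈ X hp)
    {b : PadicBase F p hp} (h : gen hp n • c = c + ι hp b) : b = 0 := by
  set x' : X hp := ⟨c, hc⟩ with hx'
  have hgen : genX hp n x' =
      ⟨(x' : CompletedAlgClosure F) + (⟨ι hp b, ι_mem_X hp b⟩ : X hp),
        add_mem_X hp x'.2 (ι_mem_X hp b)⟩ := Subtype.ext h
  have hR : Rhat hp n x' = Rhat hp n x' + ι hp b := by
    conv_lhs => rw [← Rhat_genX hp hn x', hgen, Rhat_add hp hn, Rhat_ι hp hn]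
  have hb : ι hp b = 0 := by
    have := congrArg (fun z => z - Rhat hp n x') hR
    simpa using this.symm
  have h2 : ι hp b = ι hp 0 := by rw [hb, ← ιHom_apply, map_zero]
  exact (ιHom hp).injective h2

/-- **Tate's `H¹` theorem over the base, scalar case.** Let `ℓ : ℤ_pˣ → K₀` be any function with
`ℓ 1 = 0`, and suppose `c ∈ ℂ_F` satisfies `g • c = c + ι ℓ(χ(g))` for all `g ∈ G₀ = Gal(F̄/ℚ_p)`. Then
`ℓ(χ(γ)) = 0` for `γ = gen n`, every `n ≥ 2`. (Indeed `c` is fixed by `ker χ`, hence `c ∈ \widehat{K_∞}` by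
Ax–Sen–Tate, and the coboundary criterion applies.) [cite: Tate1967, §3.3 Theorem 1]
[cite: FontaineOuyang2022, §3.2 Thm. 3.21] -/
theorem apply_chi_gen_eq_zero_of_forall_smul_eq_add (ℓ : ℤ_[p]ˣ → PadicBase F p hp) (hℓ1 : ℓ 1 = 0)
    {c : CompletedAlgClosure F}
    (hc : ∀ g : BaseGaloisGroup hp, g • c = c + ι hp (ℓ (BaseGaloisGroup.baseCyclotomicCharacter hp g)))
    (hn : 2 ≤ n) : ℓ (BaseGaloisGroup.baseCyclotomicCharacter hp (gen hp n)) = 0 := by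
  have hcX : c ∈ X hp := by
    rw [← fixedPoints_eq_X hp]
    intro g hg
    rw [hc g, chi_eq_one_of_forall_smul_zeta hp hg, hℓ1, ← ιHom_apply, map_zero, add_zero]
  exact eq_zero_of_gen_smul_eq_add hp hn hcX (hc (gen hp n))

/-- `ι` on an element of `ℚ_p` (through `K₀ = ℚ_p → F → ℂ_F`) is the canonical scalar
`ℚ_p → F → ℂ_F`. [folklore] -/
theorem ι_toPadic_symm (q : ℚ_[p]) :
    ι hp ((PadicBase.toPadic hp).symm q) =
      algebraMap F (CompletedAlgClosure F) (LocalField.padicRingHom F p hp q) := by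
  rw [ι_def, PadicBase.algebraMap_eq, PadicBase.emb_apply, RingEquiv.apply_symm_apply]

end TateTrace

namespace TateDescent

/-! ### Descent from `G₀ = Gal(F̄/ℚ_p)` to `Γ_F`: the additive (trace) transfer -/

omit [TopologicalSpace F] [IsNonarchimedeanLocalField F] [CharZero F] in
/-- A logarithmic function kills `1`. [folklore] -/
private theorem apply_one_eq_zero {ℓ : ℤ_[p]ˣ → PadicBase F p hp} (hℓ : ∀ u v, ℓ (u * v) = ℓ u + ℓ v) :
    ℓ 1 = 0 := by
  have h := hℓ 1 1
  rw [one_mul] at h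
  linear_combination (-1 : PadicBase F p hp) * h

omit [TopologicalSpace F] [IsNonarchimedeanLocalField F] [CharZero F] in
/-- A logarithmic function turns finite products into sums. [folklore] -/
private theorem apply_prod_eq_sum {ℓ : ℤ_[p]ˣ → PadicBase F p hp} (hℓ : ∀ u v, ℓ (u * v) = ℓ u + ℓ v)
    {ι' : Type*} (s : Finset ι') (f : ι' → ℤ_[p]ˣ) : ℓ (∏ i ∈ s, f i) = ∑ i ∈ s, ℓ (f i) := by
  classical
  induction s using Finset.induction_on with
  | empty => rw [Finset.prod_empty, Finset.sum_empty, apply_one_eq_zero hp hℓ]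
  | insert a s ha ih => rw [Finset.prod_insert ha, hℓ, ih, Finset.sum_insert ha]

omit [TopologicalSpace F] [IsNonarchimedeanLocalField F] [CharZero F] in
/-- A logarithmic function on powers: `ℓ (u ^ d) = d · ℓ u`. [folklore] -/
private theorem apply_pow_eq_natCast_mul {ℓ : ℤ_[p]ˣ → PadicBase F p hp} (hℓ : ∀ u v, ℓ (u * v) = ℓ u + ℓ v)
    (u : ℤ_[p]ˣ) (d : ℕ) : ℓ (u ^ d) = (d : PadicBase F p hp) * ℓ u := by
  induction d with
  | zero => rw [pow_zero, apply_one_eq_zero hp hℓ, Nat.cast_zero, zero_mul]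
  | succ d ih => rw [pow_succ, hℓ, ih]; push_cast; ring

/-- **`∏_φ χ(h_φ) = χ(g)^d`** for the corrections `h_φ = s_{gφ}⁻¹ g s_φ` (`d = #Emb = [F : ℚ_p]`): the
transfer of the cyclotomic character. [cite: Tate1967, §3.3] -/
theorem prod_chi_corr (g : BaseGaloisGroup hp) :
    ∏ φ : Emb hp, BaseGaloisGroup.baseCyclotomicCharacter hp (corr hp g φ) =
      BaseGaloisGroup.baseCyclotomicCharacter hp g ^ Fintype.card (Emb hp) := by
  classical
  have hW : ∀ φ : Emb hp, BaseGaloisGroup.baseCyclotomicCharacter hp (corr hp g φ) =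
      (BaseGaloisGroup.baseCyclotomicCharacter hp (liftEmb hp (permEmb hp g φ)))⁻¹ *
        (BaseGaloisGroup.baseCyclotomicCharacter hp g *
          BaseGaloisGroup.baseCyclotomicCharacter hp (liftEmb hp φ)) := by
    intro φ
    rw [corr, map_mul, map_mul, map_inv, mul_assoc]
  rw [Finset.prod_congr rfl fun φ _ => hW φ, Finset.prod_mul_distrib, Finset.prod_mul_distrib,
    Finset.prod_inv_distrib, Finset.prod_const, Finset.card_univ,
    Equiv.prod_comp (permEmb hp g) (fun φ => BaseGaloisGroup.baseCyclotomicCharacter hp (liftEmb hp φ)),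
    mul_comm (BaseGaloisGroup.baseCyclotomicCharacter hp g ^ _), ← mul_assoc, inv_mul_cancel, one_mul]

/-- **Transformation of the trace** (additive twin of `smul_norm_eq`). If `h • c = c + ι ℓ(χ(h))` for all
`h ∈ Γ_F` (as elements `toBase σ` of `G₀`), with `ℓ` logarithmic, then `y = Σ_φ s_φ • c` satisfies
`g • y = y + ι ℓ(χ(g)^d)` for all `g ∈ G₀`, `d = #Emb = [F : ℚ_p]`. [cite: Tate1967, §3.3] -/
theorem smul_sum_liftEmb_eq (ℓ : ℤ_[p]ˣ → PadicBase F p hp) (hℓ : ∀ u v, ℓ (u * v) = ℓ u + ℓ v)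
    {c : CompletedAlgClosure F}
    (hc : ∀ σ : absoluteGaloisGroup F, BaseGaloisGroup.toBase hp σ • c =
      c + TateTrace.ι hp (ℓ (BaseGaloisGroup.baseCyclotomicCharacter hp (BaseGaloisGroup.toBase hp σ))))
    (g : BaseGaloisGroup hp) :
    g • (∑ φ : Emb hp, liftEmb hp φ • c) =
      (∑ φ : Emb hp, liftEmb hp φ • c) +
        TateTrace.ι hp (ℓ (BaseGaloisGroup.baseCyclotomicCharacter hp g ^ Fintype.card (Emb hp))) := by
  classical
  -- each summand: `g • s_φ • c = s_{gφ} • c + ι ℓ(χ(h_φ))`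
  have hfac : ∀ φ : Emb hp, g • (liftEmb hp φ • c) =
      liftEmb hp (permEmb hp g φ) • c +
        TateTrace.ι hp (ℓ (BaseGaloisGroup.baseCyclotomicCharacter hp (corr hp g φ))) := by
    intro φ
    obtain ⟨σ, hσ⟩ := exists_toBase_eq_corr hp g φ
    have hcorr : corr hp g φ • c =
        c + TateTrace.ι hp (ℓ (BaseGaloisGroup.baseCyclotomicCharacter hp (corr hp g φ))) := by
      rw [← hσ]; exact hc σ
    rw [← mul_smul, mul_liftEmb, mul_smul, hcorr, smul_add, TateTrace.base_smul_ι]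
  -- the sum
  have hsum : g • (∑ φ : Emb hp, liftEmb hp φ • c) = ∑ φ : Emb hp, g • (liftEmb hp φ • c) :=
    map_sum (MulSemiringAction.toRingHom (BaseGaloisGroup hp) (CompletedAlgClosure F) g) _ _
  rw [hsum, Finset.sum_congr rfl fun φ _ => hfac φ, Finset.sum_add_distrib,
    Equiv.sum_comp (permEmb hp g) (fun φ => liftEmb hp φ • c)]
  congr 1
  -- the scalar: `Σ_φ ι ℓ(χ(h_φ)) = ι ℓ(∏_φ χ(h_φ)) = ι ℓ(χ(g)^d)`
  have h1 : ∑ φ : Emb hp, TateTrace.ι hp (ℓ (BaseGaloisGroup.baseCyclotomicCharacter hp (corr hp g φ))) =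
      TateTrace.ι hp (∑ φ : Emb hp, ℓ (BaseGaloisGroup.baseCyclotomicCharacter hp (corr hp g φ))) := by
    simp only [← TateTrace.ιHom_apply]; exact (map_sum (TateTrace.ιHom hp) _ _).symm
  rw [h1, ← apply_prod_eq_sum hp hℓ, prod_chi_corr]

/-- **Descent to `Γ_F`** (still phrased with `toBase σ ∈ G₀`): if `toBase σ • c = c + ι ℓ(χ(toBase σ))` for
all `σ ∈ Γ_F`, `ℓ` logarithmic, then `ℓ(χ(γ)) = 0` for `γ = gen n`, `n ≥ 2`: the base case for the
trace `Σ_φ s_φ • c` and `u ↦ ℓ(u^d)` gives `d · ℓ(χ γ) = 0`. [cite: Tate1967, §3.3 Theorem 1] -/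
theorem apply_chi_gen_eq_zero_of_forall_toBase_smul_eq_add (ℓ : ℤ_[p]ˣ → PadicBase F p hp)
    (hℓ : ∀ u v, ℓ (u * v) = ℓ u + ℓ v) {c : CompletedAlgClosure F}
    (hc : ∀ σ : absoluteGaloisGroup F, BaseGaloisGroup.toBase hp σ • c =
      c + TateTrace.ι hp (ℓ (BaseGaloisGroup.baseCyclotomicCharacter hp (BaseGaloisGroup.toBase hp σ))))
    {n : ℕ} (hn : 2 ≤ n) :
    ℓ (BaseGaloisGroup.baseCyclotomicCharacter hp (TateTrace.gen hp n)) = 0 := by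
  classical
  have hd : ((Fintype.card (Emb hp) : ℕ) : PadicBase F p hp) ≠ 0 :=
    Nat.cast_ne_zero.mpr Fintype.card_ne_zero
  have key := TateTrace.apply_chi_gen_eq_zero_of_forall_smul_eq_add hp
    (fun u => ℓ (u ^ Fintype.card (Emb hp))) (by rw [one_pow, apply_one_eq_zero hp hℓ])
    (c := ∑ φ : Emb hp, liftEmb hp φ • c) (fun g => smul_sum_liftEmb_eq hp ℓ hℓ hc g) hn
  rw [apply_pow_eq_natCast_mul hp hℓ] at key
  exact (mul_eq_zero.mp key).resolve_left hd

end TateDescent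

/-! ### The theorem for `Γ_F`: `log χ_cyclo` spans a line in `H¹(Γ_F, ℂ_F)` -/

namespace CompletedAlgClosure

/-- **Tate's theorem, `H¹` half, scalar case: `[log χ_cyclo] ≠ 0` in `H¹(Γ_F, ℂ_F)`.** Let `F` be a
non-archimedean local field of characteristic `0` and residue characteristic `p`, and `a ∈ ℚ_p`, `a ≠ 0`.
There is NO `c ∈ ℂ_F` with
  `σ • c = c + a · log χ_F(σ)`  for all `σ ∈ Γ_F`
(`log χ_F = logCyclotomic p`, the scalar mapped through `ℚ_p → F → ℂ_F` by `LocalField.padicRingHom`):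
the continuous cocycle `a · log χ_cyclo` is not a coboundary, i.e. the line `ℚ_p · [log χ]` injects into
`H¹(Γ_F, ℂ_F)` (Tate 1967 §3.3 Thm. 1 gives `H¹(Γ_F, ℂ_F) = F · [log χ]`; only the non-vanishing is proved
here). Proof: trace transfer to `Gal(F̄/ℚ_p)`, Ax–Sen–Tate, Tate's normalised trace `R_n` (additive,
identity on `ℚ_p`, `R_n ∘ γ = R_n`), and `log_p u = 0 ⇒ u` torsion against `χ(γ) = 1 + p^n a` of infinite
order. [cite: Tate1967, §3.3 Theorem 1] [cite: FontaineOuyang2022, §3.2 Thm. 3.21]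
[cite: Kato1993LNM1553, Ch. II §1.2.2 and Prop. 1.2.3] -/
theorem not_exists_smul_eq_add_logCyclotomic {a : ℚ_[p]} (ha : a ≠ 0) :
    ¬ ∃ c : CompletedAlgClosure F, ∀ σ : absoluteGaloisGroup F,
      σ • c = c + algebraMap F (CompletedAlgClosure F)
        (LocalField.padicRingHom F p hp (a * logCyclotomic p σ)) := by
  rintro ⟨c, hc⟩
  have hnorm : ∀ u : ℤ_[p]ˣ, ‖((u : ℤ_[p]) : ℚ_[p])‖ = 1 := fun u => by
    rw [← PadicInt.norm_def]; exact PadicInt.isUnit_iff.1 u.isUnit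
  -- the logarithmic function `ℓ = a · log_p` with values in `K₀`
  have hℓ : ∀ u v : ℤ_[p]ˣ,
      (PadicBase.toPadic hp).symm (a * Literature.IUT.LogVolume.unitLog (((u * v : ℤ_[p]ˣ) : ℤ_[p]) : ℚ_[p])) =
        (PadicBase.toPadic hp).symm (a * Literature.IUT.LogVolume.unitLog (((u : ℤ_[p]) : ℚ_[p]))) +
          (PadicBase.toPadic hp).symm (a * Literature.IUT.LogVolume.unitLog (((v : ℤ_[p]) : ℚ_[p]))) := by
    intro u v
    rw [← map_add, ← mul_add, Units.val_mul, PadicInt.coe_mul,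
      Literature.IUT.LogVolume.unitLog_mul p (hnorm u) (hnorm v)]
  -- the hypothesis over `G₀`
  have hc' : ∀ σ : absoluteGaloisGroup F, BaseGaloisGroup.toBase hp σ • c =
      c + TateTrace.ι hp ((PadicBase.toPadic hp).symm (a * Literature.IUT.LogVolume.unitLog
        (((BaseGaloisGroup.baseCyclotomicCharacter hp (BaseGaloisGroup.toBase hp σ) : ℤ_[p]ˣ) : ℤ_[p]) :
          ℚ_[p]))) := by
    intro σ
    rw [toBase_smul_completion, hc σ, BaseGaloisGroup.baseCyclotomicCharacter_toBase, TateTrace.ι_toPadic_symm]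
    rfl
  have key := TateDescent.apply_chi_gen_eq_zero_of_forall_toBase_smul_eq_add hp
    (fun u : ℤ_[p]ˣ => (PadicBase.toPadic hp).symm
      (a * Literature.IUT.LogVolume.unitLog (((u : ℤ_[p]) : ℚ_[p])))) hℓ hc' (n := 2) le_rfl
  -- `a · log_p χ(γ) = 0`, hence `log_p χ(γ) = 0`, hence `χ(γ)` is a root of unity
  have hlog : Literature.IUT.LogVolume.unitLog
      (((BaseGaloisGroup.baseCyclotomicCharacter hp (TateTrace.gen hp 2) : ℤ_[p]ˣ) : ℤ_[p]) : ℚ_[p]) = 0 := by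
    have h1 : a * Literature.IUT.LogVolume.unitLog
        (((BaseGaloisGroup.baseCyclotomicCharacter hp (TateTrace.gen hp 2) : ℤ_[p]ˣ) : ℤ_[p]) : ℚ_[p]) = 0 :=
      (PadicBase.toPadic hp).symm.injective (by rw [map_zero]; exact key)
    exact (mul_eq_zero.mp h1).resolve_left ha
  obtain ⟨m, hm, hum⟩ :=
    (Literature.IUT.LogVolume.unitLog_eq_zero_iff p ℚ_[p] (hnorm _)).mp hlog
  have hum' : ((BaseGaloisGroup.baseCyclotomicCharacter hp (TateTrace.gen hp 2) : ℤ_[p]ˣ) : ℤ_[p]) ^ m = 1 := by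
    apply Subtype.ext
    push_cast
    exact hum
  -- … contradicting the infinite order of `χ(γ)`
  exact TateTrace.zpow_chi_gen_ne_one hp (n := 2) le_rfl (j := (m : ℤ)) (by exact_mod_cast hm.ne')
    (by rw [zpow_natCast, ← map_pow, hum', map_one])

/-- **`log χ_cyclo` itself is not a coboundary in `ℂ_F`** (the case `a = 1` of
`not_exists_smul_eq_add_logCyclotomic`): there is no `c ∈ ℂ_F` with `σ • c = c + log χ_F(σ)` for all
`σ ∈ Γ_F`. [cite: Tate1967, §3.3 Theorem 1] [cite: Kato1993LNM1553, Ch. II §1.2.2 and Prop. 1.2.3] -/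
theorem not_exists_smul_eq_add_logCyclotomic_one :
    ¬ ∃ c : CompletedAlgClosure F, ∀ σ : absoluteGaloisGroup F,
      σ • c = c + algebraMap F (CompletedAlgClosure F)
        (LocalField.padicRingHom F p hp (logCyclotomic p σ)) := by
  rintro ⟨c, hc⟩
  exact not_exists_smul_eq_add_logCyclotomic hp (one_ne_zero (α := ℚ_[p]))
    ⟨c, fun σ => by rw [one_mul]; exact hc σ⟩

/-- **The `F`-line `F · [log χ_cyclo]` injects into `H¹(Γ_F, ℂ_F)`**: for `a ∈ F`, `a ≠ 0`, there is no
`c ∈ ℂ_F` with `σ • c = c + a · log χ_F(σ)` for all `σ ∈ Γ_F` (divide by `a`, which `Γ_F` fixes, and apply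
the case `a = 1`). Tate 1967 §3.3 Thm. 1 asserts moreover `H¹(Γ_F, ℂ_F) = F · [log χ]` (not proved here).
[cite: Tate1967, §3.3 Theorem 1] [cite: FontaineOuyang2022, §3.2 Thm. 3.21] -/
theorem not_exists_smul_eq_add_mul_logCyclotomic {a : F} (ha : a ≠ 0) :
    ¬ ∃ c : CompletedAlgClosure F, ∀ σ : absoluteGaloisGroup F,
      σ • c = c + algebraMap F (CompletedAlgClosure F) a *
        algebraMap F (CompletedAlgClosure F) (LocalField.padicRingHom F p hp (logCyclotomic p σ)) := by
  rintro ⟨c, hc⟩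
  have ha' : algebraMap F (CompletedAlgClosure F) a ≠ 0 := by
    rw [Ne, map_eq_zero_iff _ (algebraMap F (CompletedAlgClosure F)).injective]; exact ha
  refine not_exists_smul_eq_add_logCyclotomic_one hp ⟨c * (algebraMap F (CompletedAlgClosure F) a)⁻¹, fun σ => ?_⟩
  rw [smul_mul', smul_inv'', smul_algebraMap, hc σ, add_mul, mul_assoc,
    mul_comm (algebraMap F (CompletedAlgClosure F) (LocalField.padicRingHom F p hp (logCyclotomic p σ))),
    ← mul_assoc (algebraMap F (CompletedAlgClosure F) a), mul_inv_cancel₀ ha', one_mul]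

end CompletedAlgClosure

end Literature.NumberTheory.PAdicHodge

end
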